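import Summits.Schanuel.Schanuel.Theses.GaussianStokesSector

/-!
# Birth skeleton (BC3) for piece X₂ `GaussValueRelTranscendental` (stmt-Schanuel-18738):
# π-relative Shidlovskii for the confluent Gaussian E-function

Piece X₂: for every real algebraic `a > 0`, `F(a) = ∫₀¹ e^{-a x²} dx` is transcendental over `ℚ(e^a, π)`.
The line has the shape of every Siegel–Shidlovskii theorem — FUNCTIONAL transcendence ⇒ NUMERICAL
transcendence at algebraic points — with one new feature: the coefficient field of the numerical
conclusion is `ℚ̄(π)` instead of `ℚ̄`.

* `stub_functionalTranscendence` (PROVABLE, L; Liouville/Kolchin–Ostrowski): the functions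
  `z, e^{-z}, F(z)` are algebraically independent over `ℂ` on `(0, ∞)` — i.e. the E-function
  `F(z) = Σ (−z)ⁿ/(n!(2n+1)) = γ(½, z)/(2√z)`, solution of `2zF′ + F = e^{-z}`, is transcendental over
  `ℂ(z, e^{-z})` (an algebraic solution of the inhomogeneous first-order equation would force a solution
  in `ℂ(z, e^{-z})` itself, impossible by the `z^{-1/2}` / `e^{-z} × (divergent series)` asymptotics at
  `+∞`).  It is also the missing Mathlib-side input of the route's KNOWN support item
  `GaussianEValuesIndependent` (Shidlovskii's pair `trdeg ℚ̄(e^a, F(a)) = 2`).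
* `stub_piRelativeTransfer` (OPEN, the heart): functional transcendence of `F` over `ℂ(z, e^{-z})`
  transfers to the transcendence of the VALUE `F(a)` over `ℚ(π)(e^{a})` at every real algebraic `a > 0`
  — a π-RELATIVE zero estimate / Shidlovskii lemma. Over the coefficient field `ℚ̄` this transfer IS the
  Siegel–Shidlovskii theorem (tree: `Literature.Barriers.Schanuel.siegelShidlovskii_algIndep_holds`);
  relative versions over an arbitrary base `k ⊂ ℂ` are false (`k = ℚ(F(a))`), so the proof must use
  that `π` is a G-value / period independent of E-values (Fischler–Rivoal's `E ∩ G = ℚ̄` circle,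
  arXiv:2301.13518 p. 3).
-/

namespace Summit.Schanuel.Schanuel.Cruxes.GaussValueRelTranscendental.PiRelativeShidlovskii

open Summit.Schanuel.Schanuel.Theses

/-- STUB 1 (provable, L): `(z, e^{-z}, ∫₀¹e^{-zx²}dx)` are algebraically independent over `ℂ` as
functions on `(0, ∞)`. -/
theorem stub_functionalTranscendence :
    ∀ P : MvPolynomial (Fin 3) ℂ,
      (∀ z : ℝ, 0 < z →
        MvPolynomial.eval ![(z : ℂ), Complex.exp (-(z : ℂ)),
          ((∫ x in (0:ℝ)..1, Real.exp (-(z * x ^ 2)) : ℝ) : ℂ)] P = 0) →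
      P = 0 := by
  sorry

/-- STUB 2 (open, the heart): the π-RELATIVE SHIDLOVSKII TRANSFER for the Gaussian E-function —
functional transcendence over `ℂ(z, e^{-z})` ⇒ transcendence of the value `F(a)` over `ℚ(e^a, π)` at
every real algebraic point `a > 0`. -/
theorem stub_piRelativeTransfer :
    (∀ P : MvPolynomial (Fin 3) ℂ,
      (∀ z : ℝ, 0 < z →
        MvPolynomial.eval ![(z : ℂ), Complex.exp (-(z : ℂ)),
          ((∫ x in (0:ℝ)..1, Real.exp (-(z * x ^ 2)) : ℝ) : ℂ)] P = 0) →
      P = 0) →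
    ∀ a : ℝ, IsAlgebraic ℚ a → 0 < a →
      Transcendental ↥(IntermediateField.adjoin ℚ ({Real.exp a, Real.pi} : Set ℝ))
        (∫ x in (0:ℝ)..1, Real.exp (-(a * x ^ 2))) := by
  sorry

/-- The composition concludes piece X₂ BY NAME from the two stubs. -/
theorem GaussValueRelTranscendental_of : GaussianStokesSector.GaussValueRelTranscendental := by
  unfold GaussianStokesSector.GaussValueRelTranscendental
  exact stub_piRelativeTransfer stub_functionalTranscendence

end Summit.Schanuel.Schanuel.Cruxes.GaussValueRelTranscendental.PiRelativeShidlovskii
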